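import Literature.AlgebraicGeometry.Motives.EtalePullbackComp
import HarnessLib

/-!
# Pull-backs along endomorphisms acting trivially on the étale site are the identity on `Hⁿ_et`

`EtalePullbackComp.lean` proved `(𝟙_X)^* = id` on `Hⁿ(X_et, M)` from the isomorphism
`etaleBaseChangeId : (U ↦ U ×_X X) ≅ 𝟭`. The argument used nothing about `𝟙_X` beyond that
isomorphism of base-change functors, and this file records the general statement, in the form
needed for the **absolute Frobenius** (SGA 5 XV §§1–2; Deligne, Weil I (1.15.1) `F^* = φ⁻¹`):
if an endomorphism `f : X → X` comes with an isomorphism of functors `ε : (U ↦ U ×_{X,f} X) ≅ 𝟭`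
on the small étale site `X_et` — for the absolute Frobenius `F_X`, `ε_U` is the inverse of the
relative Frobenius `F_{U/X} : U ⥲ U ×_{X,F_X} X`, an isomorphism for `U/X` étale — then

* `etalePushforwardIsoOfIso f ε : f_* ≅ 𝟭`, `etalePullbackIsoOfIso f ε : f^* ≅ 𝟭` (conjugate,
  Mathlib `Adjunction.leftAdjointIdIso`), with the unit relation
  `unit_app_comp_etalePullbackIsoOfIso_hom_app`;
* `etalePullbackIsoOfIso_hom_app_constantSheaf` : on `M_X` it is the constant-sheaf isomorphism
  `f^* M_X ≅ M_X` of `EtalePullback.lean` (constant sections, as in `EtalePullbackComp.lean`);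
* **`etaleCohomologyPullback_eq_of_iso`**, **`etaleCohomologyMap_eq_self_of_iso`** :
  `f^* = id` on `Hⁿ(X_et, F)` (after `f^* F ≅ F` by `ε`) and on `Hⁿ(X_et, M)`, by the uniqueness of
  `δ`-morphisms out of `Hⁿ(X_et, –)` (`ext_deltaMorphism`).

## References

* J. S. Milne, *Étale cohomology* (reissue 2025), II Rem. 3.1 (f), III Rem. 1.6 (c).
  [Milne2025]

## Design notes

* The proofs are those of the `Id` sections of `EtalePullbackComp.lean` with
  `etaleBaseChangeId X` replaced by the parameter `ε`; see the design notes there for the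
  `calc`/`exact` style forced by instances-transparency checks.
* What is NOT here: the isomorphism `ε` for the absolute Frobenius itself (relative Frobenius
  of an étale morphism is an isomorphism — a separate, purely scheme-theoretic statement).
-/

universe u

open CategoryTheory CategoryTheory.Limits AlgebraicGeometry Opposite

namespace Literature.AlgebraicGeometry.Motives

variable {X : Scheme.{u}} (f : X ⟶ X) (ε : etaleBaseChange f ≅ 𝟭 X.Etale)

/-! ### `f_* ≅ 𝟭` and `f^* ≅ 𝟭` from `ε` -/

section Isos

/-- **`f_* ≅ 𝟭`** when base change along `f` is isomorphic to the identity of `X_et`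
(`(f_* P)(U) = P(U ×_f X) ≅ P(U)`). [folklore] -/
noncomputable def etalePushforwardIsoOfIso : etalePushforward f Ab.{u} ≅ 𝟭 _ :=
  Functor.sheafPushforwardContinuousId' ε Ab.{u} X.smallEtaleTopology

/-- Components of `etalePushforwardIsoOfIso`: `P(U) → (f_* P)(U) = P(U ×_f X)` is restriction
along `ε_U : U ×_f X ⥲ U`. [folklore] -/
theorem etalePushforwardIsoOfIso_inv_app_hom_app (P : Sheaf X.smallEtaleTopology Ab.{u})
    (U : X.Etale) :
    ((etalePushforwardIsoOfIso f ε).inv.app P).hom.app (op U) = P.obj.map (ε.hom.app U).op := by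
  simp [etalePushforwardIsoOfIso, Functor.sheafPushforwardContinuousId',
    Functor.sheafPushforwardContinuousId, Functor.sheafPushforwardContinuousIso]
  exact Category.id_comp _

/-- **`f^* ≅ 𝟭`**, the isomorphism of left adjoints conjugate to `etalePushforwardIsoOfIso`
(Mathlib `Adjunction.leftAdjointIdIso`). [folklore] -/
noncomputable def etalePullbackIsoOfIso : etalePullback f ≅ 𝟭 _ :=
  (etalePullbackAdjunction f).leftAdjointIdIso (etalePushforwardIsoOfIso f ε)

/-- `etalePullbackIsoOfIso` is conjugate to `etalePushforwardIsoOfIso`. [folklore] -/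
theorem conjugateEquiv_etalePullbackIsoOfIso_hom :
    conjugateEquiv .id (etalePullbackAdjunction f) (etalePullbackIsoOfIso f ε).hom =
      (etalePushforwardIsoOfIso f ε).inv :=
  Adjunction.conjugateEquiv_leftAdjointIdIso_hom _ _

set_option backward.isDefEq.respectTransparency false in
/-- The unit relation defining `etalePullbackIsoOfIso`: `η_f(U) ≫ u_P(U ×_f X) = (restriction
along ε_U)`. [folklore] -/
theorem unit_app_comp_etalePullbackIsoOfIso_hom_app (P : Sheaf X.smallEtaleTopology Ab.{u})
    (U : X.Etale) :
    ((etalePullbackAdjunction f).unit.app P).hom.app (op (U)) ≫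
        ((etalePullbackIsoOfIso f ε).hom.app P).hom.app (op ((etaleBaseChange f).obj U)) =
      P.obj.map (ε.hom.app U).op := by
  have h := unit_conjugateEquiv Adjunction.id (etalePullbackAdjunction f)
    (etalePullbackIsoOfIso f ε).hom P
  rw [conjugateEquiv_etalePullbackIsoOfIso_hom] at h
  have h' := Sheaf.congr_hom_app h (op U)
  have e1 : (((Adjunction.id (C := Sheaf X.smallEtaleTopology Ab.{u})).unit.app P) ≫
      (etalePushforwardIsoOfIso f ε).inv.app P).hom.app (op U) =
      P.obj.map (ε.hom.app U).op := by
    rw [← etalePushforwardIsoOfIso_inv_app_hom_app]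
    exact Category.id_comp _
  exact h'.symm.trans e1

variable (M : Ab.{u})

set_option backward.isDefEq.respectTransparency false in
/-- **Compatibility with `π^* M ≅ M`**: on `M_X`, `etalePullbackIsoOfIso` is the constant-sheaf
isomorphism `f^* M_X ≅ M_X`. [folklore] -/
theorem etalePullbackIsoOfIso_hom_app_constantSheaf :
    (etalePullbackIsoOfIso f ε).hom.app ((constantSheaf X.smallEtaleTopology Ab.{u}).obj M) =
      (etalePullbackConstantSheafIso f M).hom := by
  rw [← Iso.inv_comp_eq_id]
  apply constantSheaf_hom_ext (isTerminalEtaleBaseChangeObjMkId f)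
  change constantSection X.smallEtaleTopology M ((etaleBaseChange f).obj (Scheme.Etale.mk (𝟙 X))) ≫
      ((etalePullbackConstantSheafIso f M).inv).hom.app (op ((etaleBaseChange f).obj (Scheme.Etale.mk (𝟙 X)))) ≫
      ((etalePullbackIsoOfIso f ε).hom.app ((constantSheaf X.smallEtaleTopology Ab.{u}).obj M)).hom.app (op ((etaleBaseChange f).obj (Scheme.Etale.mk (𝟙 X)))) =
    constantSection X.smallEtaleTopology M ((etaleBaseChange f).obj (Scheme.Etale.mk (𝟙 X))) ≫ 𝟙 _
  rw [Category.comp_id]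
  have L1 := constantSection_comp_unit_comp_constantSheafIso f M (Scheme.Etale.mk (𝟙 X))
  have hinv : ((etalePullbackConstantSheafIso f M).hom).hom.app (op ((etaleBaseChange f).obj (Scheme.Etale.mk (𝟙 X)))) ≫
      ((etalePullbackConstantSheafIso f M).inv).hom.app (op ((etaleBaseChange f).obj (Scheme.Etale.mk (𝟙 X)))) = 𝟙 _ :=
    Sheaf.congr_hom_app (etalePullbackConstantSheafIso f M).hom_inv_id (op ((etaleBaseChange f).obj (Scheme.Etale.mk (𝟙 X))))
  have hinv' : ((etalePullbackAdjunction f).unit.app ((constantSheaf X.smallEtaleTopology Ab.{u}).obj M)).hom.app (op (Scheme.Etale.mk (𝟙 X))) ≫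
      ((etalePullbackConstantSheafIso f M).hom).hom.app (op ((etaleBaseChange f).obj (Scheme.Etale.mk (𝟙 X)))) ≫
      ((etalePullbackConstantSheafIso f M).inv).hom.app (op ((etaleBaseChange f).obj (Scheme.Etale.mk (𝟙 X)))) =
      ((etalePullbackAdjunction f).unit.app ((constantSheaf X.smallEtaleTopology Ab.{u}).obj M)).hom.app (op (Scheme.Etale.mk (𝟙 X))) := by
    rw [hinv]; exact Category.comp_id _
  have s1 : constantSection X.smallEtaleTopology M ((etaleBaseChange f).obj (Scheme.Etale.mk (𝟙 X))) ≫
      ((etalePullbackConstantSheafIso f M).inv).hom.app (op ((etaleBaseChange f).obj (Scheme.Etale.mk (𝟙 X)))) =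
      constantSection X.smallEtaleTopology M (Scheme.Etale.mk (𝟙 X)) ≫ ((etalePullbackAdjunction f).unit.app ((constantSheaf X.smallEtaleTopology Ab.{u}).obj M)).hom.app (op (Scheme.Etale.mk (𝟙 X))) := by
    rw [← L1]; simp only [Category.assoc]; rw [hinv']
  have s2 : ((etalePullbackAdjunction f).unit.app ((constantSheaf X.smallEtaleTopology Ab.{u}).obj M)).hom.app (op (Scheme.Etale.mk (𝟙 X))) ≫
      ((etalePullbackIsoOfIso f ε).hom.app ((constantSheaf X.smallEtaleTopology Ab.{u}).obj M)).hom.app (op ((etaleBaseChange f).obj (Scheme.Etale.mk (𝟙 X)))) =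
      ((constantSheaf X.smallEtaleTopology Ab.{u}).obj M).obj.map (ε.hom.app (Scheme.Etale.mk (𝟙 X))).op :=
    unit_app_comp_etalePullbackIsoOfIso_hom_app f ε ((constantSheaf X.smallEtaleTopology Ab.{u}).obj M) (Scheme.Etale.mk (𝟙 X))
  have s3 : constantSection X.smallEtaleTopology M (Scheme.Etale.mk (𝟙 X)) ≫ ((constantSheaf X.smallEtaleTopology Ab.{u}).obj M).obj.map (ε.hom.app (Scheme.Etale.mk (𝟙 X))).op =
      constantSection X.smallEtaleTopology M ((etaleBaseChange f).obj (Scheme.Etale.mk (𝟙 X))) :=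
    constantSection_comp_map X.smallEtaleTopology M (ε.hom.app (Scheme.Etale.mk (𝟙 X)))
  calc constantSection X.smallEtaleTopology M ((etaleBaseChange f).obj (Scheme.Etale.mk (𝟙 X))) ≫
      ((etalePullbackConstantSheafIso f M).inv).hom.app (op ((etaleBaseChange f).obj (Scheme.Etale.mk (𝟙 X)))) ≫
      ((etalePullbackIsoOfIso f ε).hom.app ((constantSheaf X.smallEtaleTopology Ab.{u}).obj M)).hom.app (op ((etaleBaseChange f).obj (Scheme.Etale.mk (𝟙 X))))
      = (constantSection X.smallEtaleTopology M ((etaleBaseChange f).obj (Scheme.Etale.mk (𝟙 X))) ≫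
          ((etalePullbackConstantSheafIso f M).inv).hom.app (op ((etaleBaseChange f).obj (Scheme.Etale.mk (𝟙 X))))) ≫
          ((etalePullbackIsoOfIso f ε).hom.app ((constantSheaf X.smallEtaleTopology Ab.{u}).obj M)).hom.app (op ((etaleBaseChange f).obj (Scheme.Etale.mk (𝟙 X)))) := by simp only [Category.assoc]
    _ = (constantSection X.smallEtaleTopology M (Scheme.Etale.mk (𝟙 X)) ≫ ((etalePullbackAdjunction f).unit.app ((constantSheaf X.smallEtaleTopology Ab.{u}).obj M)).hom.app (op (Scheme.Etale.mk (𝟙 X)))) ≫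
          ((etalePullbackIsoOfIso f ε).hom.app ((constantSheaf X.smallEtaleTopology Ab.{u}).obj M)).hom.app (op ((etaleBaseChange f).obj (Scheme.Etale.mk (𝟙 X)))) := by rw [s1]
    _ = constantSection X.smallEtaleTopology M (Scheme.Etale.mk (𝟙 X)) ≫ (((etalePullbackAdjunction f).unit.app ((constantSheaf X.smallEtaleTopology Ab.{u}).obj M)).hom.app (op (Scheme.Etale.mk (𝟙 X))) ≫
          ((etalePullbackIsoOfIso f ε).hom.app ((constantSheaf X.smallEtaleTopology Ab.{u}).obj M)).hom.app (op ((etaleBaseChange f).obj (Scheme.Etale.mk (𝟙 X))))) := by simp only [Category.assoc]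
    _ = constantSection X.smallEtaleTopology M (Scheme.Etale.mk (𝟙 X)) ≫ ((constantSheaf X.smallEtaleTopology Ab.{u}).obj M).obj.map (ε.hom.app (Scheme.Etale.mk (𝟙 X))).op := by rw [s2]
    _ = constantSection X.smallEtaleTopology M ((etaleBaseChange f).obj (Scheme.Etale.mk (𝟙 X))) := s3

end Isos

/-! ### `f^* = id` on cohomology -/

section Cohomology

open Abelian

set_option backward.isDefEq.respectTransparency false in
/-- **`f^* = id` on `Hⁿ(X_et, F)`** (after `f^* F ≅ F` by `etalePullbackIsoOfIso`) whenever base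
change along `f` is isomorphic to the identity of `X_et`: both sides are `δ`-morphisms out of
`Hⁿ(X_et, –)` agreeing in degree `0` (`ext_deltaMorphism`). [cite: Milne2025, III Remark 1.6 (c)] -/
theorem etaleCohomologyPullback_eq_of_iso (F : Sheaf X.smallEtaleTopology Ab.{u}) (n : ℕ)
    (x : F.H n) :
    Sheaf.H.map ((etalePullbackIsoOfIso f ε).hom.app F) n (etaleCohomologyPullback f F n x) = x := by
  have key := ext_deltaMorphism (𝟭 (Sheaf X.smallEtaleTopology Ab.{u}))
    (A := (constantSheaf X.smallEtaleTopology Ab.{u}).obj (AddCommGrpCat.of (ULift.{u} ℤ)))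
    (B := (constantSheaf X.smallEtaleTopology Ab.{u}).obj (AddCommGrpCat.of (ULift.{u} ℤ)))
    (fun F n x => Sheaf.H.map ((etalePullbackIsoOfIso f ε).hom.app F) n
      (etaleCohomologyPullback f F n x))
    (fun F n x => x) ?_ ?_ ?_
  · exact congrFun (congrFun (congrFun key F) n) x
  · intro S hS n x
    change Sheaf.H.map ((etalePullbackIsoOfIso f ε).hom.app S.X₁) (n + 1)
        (etaleCohomologyPullback f _ (n + 1) (x.comp hS.extClass rfl)) =
      (Sheaf.H.map ((etalePullbackIsoOfIso f ε).hom.app S.X₃) n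
        (etaleCohomologyPullback f _ n x)).comp
          (hS.map_of_exact (𝟭 _)).extClass rfl
    have nat : (hS.map_of_exact (etalePullback f)).extClass.comp
        (Ext.mk₀ ((etalePullbackIsoOfIso f ε).hom.app S.X₁)) (add_zero 1) =
        (Ext.mk₀ ((etalePullbackIsoOfIso f ε).hom.app S.X₃)).comp
          (hS.map_of_exact (𝟭 _)).extClass (zero_add 1) :=
      (hS.map_of_exact (etalePullback f)).extClass_naturality
        (hS.map_of_exact (𝟭 _)) (S.mapNatTrans (etalePullbackIsoOfIso f ε).hom)
    rw [etaleCohomologyPullback_comp_extClass, Sheaf.H.map_apply, Sheaf.H.map_apply,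
      Ext.comp_assoc_of_third_deg_zero, nat, Ext.comp_assoc_of_second_deg_zero]
  · intro S hS n x
    rfl
  · intro F x
    obtain ⟨x₀, rfl⟩ := (Ext.mk₀_bijective _ _).2 x
    change Sheaf.H.map ((etalePullbackIsoOfIso f ε).hom.app F) 0
        (etaleCohomologyPullback f F 0 (Ext.mk₀ x₀)) = Ext.mk₀ x₀
    have K : (etalePullbackConstantSheafIso f (AddCommGrpCat.of (ULift.{u} ℤ))).inv ≫
        (etalePullbackIsoOfIso f ε).hom.app _ = 𝟙 _ := by
      rw [etalePullbackIsoOfIso_hom_app_constantSheaf, Iso.inv_hom_id]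
    simp only [etaleCohomologyPullback_apply, Ext.mapExactFunctor_mk₀, Ext.mk₀_comp_mk₀,
      Sheaf.H.map_apply, Category.assoc]
    rw [(etalePullbackIsoOfIso f ε).hom.naturality x₀, reassoc_of% K]
    rfl

/-- **`f^* = id` on `Hⁿ(X_et, M)`** whenever base change along `f` is isomorphic to the identity
of `X_et` — the form used for the absolute Frobenius. [cite: Milne2025, III Remark 1.6 (c)] -/
theorem etaleCohomologyMap_eq_self_of_iso {X : Scheme.{u}} (f : X ⟶ X)
    (ε : etaleBaseChange f ≅ 𝟭 X.Etale) (M : Ab.{u}) (n : ℕ)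
    (x : ((constantSheaf X.smallEtaleTopology Ab.{u}).obj M).H n) :
    etaleCohomologyMap f M n x = x := by
  rw [etaleCohomologyMap_apply, ← etalePullbackIsoOfIso_hom_app_constantSheaf f ε]
  exact etaleCohomologyPullback_eq_of_iso f ε _ n x

end Cohomology

end Literature.AlgebraicGeometry.Motives
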